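import Literature.NumberTheory.LFunctions.TitchmarshGRHCriterion
import Literature.NumberTheory.LFunctions.GRHCharacterPrimeSumsProofs
import Literature.NumberTheory.LFunctions.VonKochTheorem
import Literature.NumberTheory.LFunctions.VonMangoldtLaplaceProgressions
import Literature.NumberTheory.LFunctions.DirichletLFunctionZeroReflection
import Literature.NumberTheory.LFunctions.GeneralizedRH
import Literature.NumberTheory.Sieve.BombieriVinogradovReduction
import HarnessLib

/-!
# RH-EQUIVALENT (GRH form) · Titchmarsh's criterion `GRH ⟺ ψ(x; q, a) = x/φ(q) + O(x^{1/2} log² x)` uniformly in `q ≤ x` — PROVED as an equivalence; nothing here bears on the truth of RH (or GRH)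

Topic `Literature/NumberTheory/LFunctions`. THEOREMS only (no definition, no named fact).
DISCHARGE of the named fact `Literature.NumberTheory.LFunctions.Titchmarsh1930_GRH_criterion`
(`TitchmarshGRHCriterion.lean`; Broughan, *Equivalents of the Riemann Hypothesis* Vol. 2, Ch. 12
"Dirichlet L-Functions", §§12.6–12.7 "Titchmarsh's GRH equivalence", pp. 295–298 — in Broughan's
words (Ch. 12, p. 287) the chapter has "really only one 'equivalence', and that is to GRH"; the
statement is typed from Bordellès, *Arithmetic Tales* (2020) Thm 3.42; primary source
E. C. Titchmarsh, *A divisor problem*, Rend. Circ. Mat. Palermo 54 (1930) 414–429):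

  **`Titchmarsh1930_GRH_criterion_holds`** : `GeneralizedRiemannHypothesis ↔ ∃ C, ∀ x ≥ 2,
  ∀ 1 ≤ q ≤ x, ∀ a ∈ (ℤ/q)ˣ, |ψ(x; q, a) − x/φ(q)| ≤ C x^{1/2} (log x)²`.

LINE 1 — LABEL: RH-EQUIVALENT literature (a kernel proof of a printed GRH-equivalence AS an
equivalence). WHAT THIS IS NOT: not a route, not progress toward RH or GRH; nothing here bears
on the truth of RH.

## The printed proof and the road taken here

(⟹, Titchmarsh 1930 = Montgomery–Vaughan Thm 13.7 / Cor. 13.8.) MV p. 425: under GRH, for a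
primitive `χ⋆` mod `d > 1`, `ψ(x, χ⋆) ≪ x^{1/2} (log x)(log dx)` (13.19); a character `χ` mod `q`
induced by `χ⋆` has `|ψ(x, χ) − ψ(x, χ⋆)| ≤ ∑_{n ≤ x, (n,q)>1} Λ(n) ≪ (log x)(log q)` (12.13); for
the principal character `ψ(x, χ₀) = ψ(x) + O((log x)(log q))` and `ψ(x) = x + O(x^{1/2} log² x)`
(von Koch, Thm 13.1); then orthogonality `ψ(x; q, a) = φ(q)⁻¹ ∑_χ χ̄(a) ψ(x, χ)` gives
`ψ(x; q, a) = x/φ(q) + O(x^{1/2} log² x)` for `q ≤ x` (Cor. 13.8). Every input is a tree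
theorem: (13.19) is `GRHPrimeCharSum.exists_norm_chebyshevPsiChar_le`
(`GRHCharacterPrimeSumsProofs.lean`), von Koch is `vonKoch_chebyshevPsi_of_riemannHypothesis_holds`
(`VonKochTheorem.lean`), orthogonality and the passage to the inducing character are
`Sieve.abs_chebyshevPsiMod_sub_le` / `Sieve.norm_psiPrime_changeLevel_le` /
`Sieve.nonCoprimePart_le` (`BombieriVinogradovReduction.lean`).

(⟸, "the easy half", Bordellès Thm 3.42 / MV §15.1 for `ζ`.) From the uniform bound,
`ψ(x, χ) = ∑_{a ∈ (ℤ/d)ˣ} χ(a) (ψ(x; d, a) − x/φ(d)) ≪_d x^{1/2} log² x` for a primitive `χ` mod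
`d > 1` (`Sieve.norm_chebyshevPsiChar_le_sum_units`), hence `−L'/L(s, χ) = L(χΛ, s) =
s ∫₁^∞ ψ(x, χ) x^{−s−1} dx` (Mathlib `LSeries_eq_mul_integral`, MV Thm 1.3) continues analytically
to `Re s > 1/2`, which forces `L(s, χ) ≠ 0` there (the tree's abstract Landau step
`LaplaceProgressions.coeff_eq_zero_of_sum_logDeriv`, as in `VonKochConverse`); zeros with
`Re s < 1/2` are excluded by the reflection `ρ ↦ 1 − ρ̄` (`LFunction_one_sub_conj_eq_zero`,
functional equation); `d = 1` is von Koch's converse for `ζ`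
(`riemannHypothesis_of_chebyshevPsi_isBigO'`); imprimitive characters reduce to primitive ones
(`DirichletCharacter.riemannHypothesis_iff_primitiveCharacter_holds`).

## References

* E. C. Titchmarsh, *A divisor problem*, Rend. Circ. Mat. Palermo 54 (1930), 414–429.
  [Titchmarsh1930Divisor]
* H. L. Montgomery, R. C. Vaughan, *Multiplicative Number Theory I*, CUP 2007: Thm 13.7,
  Cor. 13.8 (p. 426), (12.13), Thm 13.1, §15.1, Thm 1.3. [MontgomeryVaughan2007]
* O. Bordellès, *Arithmetic Tales. Advanced Edition*, Springer 2020, Thm 3.42.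
  [Bordelles2020ArithmeticTales]
* K. Broughan, *Equivalents of the Riemann Hypothesis*, Vol. 2, CUP 2017, Ch. 12 §§12.6–12.7.
  [Broughan2017]
-/

noncomputable section

open Filter Asymptotics MeasureTheory Set Complex
open scoped Real Topology ArithmeticFunction.vonMangoldt LSeries.notation Chebyshev

namespace Literature.NumberTheory.LFunctions

namespace TitchmarshGRH

open Literature.NumberTheory.Sieve
open DirichletCharacter

/-! ### The twisted Chebyshev function `ψ(x, χ)` as a summatory function, and its Mellin transform -/

section Converse

variable {q : ℕ} (χ : DirichletCharacter ℂ q)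

/-- `ψ(x, χ) = ∑_{1 ≤ k ≤ ⌊x⌋} χ(k)Λ(k)`, the summatory function of the coefficients of
`L(χΛ, s) = −L'/L(s, χ)` in the summation range of `LSeries_eq_mul_integral`. [folklore] -/
private theorem chebyshevPsiChar_eq_sum_Icc (x : ℝ) :
    chebyshevPsiChar χ x = ∑ k ∈ Finset.Icc 1 ⌊x⌋₊, (↗χ * ↗Λ) k := by
  rw [chebyshevPsiChar, sum_range_succ_eq_sum_Ioc' _ (by simp), ← VonKochConverse.Icc_one_eq_Ioc_zero]
  rfl

/-- `ψ(x, χ) = 0` for `x < 1`. [folklore] -/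
private theorem chebyshevPsiChar_eq_zero_of_lt_one {x : ℝ} (hx : x < 1) : chebyshevPsiChar χ x = 0 := by
  rw [chebyshevPsiChar, Nat.floor_eq_zero.mpr hx]
  simp

/-- `ψ(·, χ)` vanishes on `(0, 1)`, so it is `O(x^{-b})` at `0⁺` for every `b`. [folklore] -/
private theorem chebyshevPsiChar_isBigO_nhdsGT_zero (b : ℝ) :
    chebyshevPsiChar χ =O[𝓝[>] 0] fun x : ℝ ↦ x ^ (-b) := by
  refine (isBigO_zero (fun x : ℝ ↦ x ^ (-b)) _).congr' ?_ EventuallyEq.rfl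
  filter_upwards [Ioo_mem_nhdsGT one_pos] with x hx
  exact (chebyshevPsiChar_eq_zero_of_lt_one χ hx.2).symm

/-- `ψ(·, χ)` is a measurable step function (it factors through `⌊·⌋₊`). [folklore] -/
private theorem measurable_chebyshevPsiChar : Measurable (chebyshevPsiChar χ) := by
  have h : chebyshevPsiChar χ = (fun N : ℕ ↦ chebyshevPsiChar χ N) ∘ (Nat.floor : ℝ → ℕ) := by
    funext x
    exact chebyshevPsiChar_eq_floor χ x
  rw [h]
  exact measurable_from_nat.comp Nat.measurable_floor

/-- `ψ(·, χ)` is locally integrable (`|ψ(x, χ)| ≤ ψ(x)`, monotone). [folklore] -/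
private theorem locallyIntegrable_chebyshevPsiChar : LocallyIntegrable (chebyshevPsiChar χ) := by
  have h1 : LocallyIntegrable (fun x : ℝ ↦ ψ x) := Chebyshev.psi_mono.locallyIntegrable
  refine (locallyIntegrableOn_univ.mpr h1).mono
    (measurable_chebyshevPsiChar χ).aestronglyMeasurable (Eventually.of_forall fun x ↦ ?_)
    |> locallyIntegrableOn_univ.mp
  rw [Real.norm_of_nonneg (Chebyshev.psi_nonneg x)]
  exact norm_chebyshevPsiChar_le_psi χ x

/-- The Mellin transform `s ↦ ∫₀^∞ ψ(x, χ) x^{-s-1} dx` is holomorphic on `Re s > σ₀` as soon as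
`ψ(x, χ) = O(x^{σ₀})` (MV §15.1 "converges for `σ > α`", in integral form).
[cite: MontgomeryVaughan2007, §15.1] -/
theorem differentiableAt_mellin {σ₀ : ℝ}
    (hψ : chebyshevPsiChar χ =O[atTop] fun x : ℝ ↦ x ^ σ₀) {s : ℂ} (hs : σ₀ < s.re) :
    DifferentiableAt ℂ (fun s ↦ mellin (chebyshevPsiChar χ) (-s)) s := by
  have hm : DifferentiableAt ℂ (mellin (chebyshevPsiChar χ)) (-s) :=
    mellin_differentiableAt_of_isBigO_rpow (a := -σ₀) (b := -s.re - 1)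
      ((locallyIntegrable_chebyshevPsiChar χ).locallyIntegrableOn _)
      (hψ.congr_right fun x ↦ by rw [neg_neg])
      (by simp only [neg_re]; linarith)
      (chebyshevPsiChar_isBigO_nhdsGT_zero χ _) (by simp only [neg_re]; linarith)
  exact hm.comp s (differentiable_neg s)

/-- **MV Thm 1.3 for `L(χΛ, s)` on `Re s > 1`**: `−L'/L(s, χ) = s ∫₁^∞ ψ(x, χ) x^{-s-1} dx`
(Mathlib `LSeries_twist_vonMangoldt_eq` and `LSeries_eq_mul_integral`).
[cite: MontgomeryVaughan2007, Thm. 1.3 (1.10)] -/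
theorem neg_logDeriv_eq [NeZero q] {σ₀ : ℝ} (hσ₀ : 0 ≤ σ₀)
    (hψ : chebyshevPsiChar χ =O[atTop] fun x : ℝ ↦ x ^ σ₀) {s : ℂ} (hs : 1 < s.re)
    (hs' : σ₀ < s.re) :
    -(deriv χ.LFunction s / χ.LFunction s) = s * mellin (chebyshevPsiChar χ) (-s) := by
  have h1 : -(deriv χ.LFunction s / χ.LFunction s) = L (↗χ * ↗Λ) s := by
    rw [DirichletCharacter.LSeries_twist_vonMangoldt_eq χ hs,
      DirichletCharacter.deriv_LFunction_eq_deriv_LSeries χ hs,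
      DirichletCharacter.LFunction_eq_LSeries χ hs, neg_div]
  have hO : (fun n : ℕ ↦ ∑ k ∈ Finset.Icc 1 n, (↗χ * ↗Λ) k) =O[atTop] fun n ↦ (n : ℝ) ^ σ₀ := by
    refine hψ.natCast_atTop.congr_left fun n ↦ ?_
    rw [chebyshevPsiChar_eq_sum_Icc, Nat.floor_natCast]
  rw [h1, LSeries_eq_mul_integral _ hσ₀ hs' (DirichletCharacter.LSeriesSummable_twist_vonMangoldt χ hs) hO]
  congr 1
  simp only [mellin]
  symm
  rw [setIntegral_eq_of_subset_of_ae_sdiff_eq_zero (t := Ioi 0) (s := Ioi 1)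
    measurableSet_Ioi.nullMeasurableSet (Ioi_subset_Ioi zero_le_one) ?_]
  · refine setIntegral_congr_fun measurableSet_Ioi fun t _ ↦ ?_
    rw [smul_eq_mul, mul_comm, chebyshevPsiChar_eq_sum_Icc, neg_add', sub_eq_add_neg]
  · filter_upwards [(Set.countable_singleton (1 : ℝ)).ae_notMem volume] with x hx1 hx
    have hx' : x < 1 := lt_of_le_of_ne (not_lt.mp hx.2) hx1
    rw [chebyshevPsiChar_eq_zero_of_lt_one χ hx', smul_zero]

/-- **MV §15.1 for a Dirichlet `L`-function** (Landau step): if `χ ≠ χ₀` mod `q` and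
`ψ(x, χ) = O(x^{σ₀})` for some `σ₀ > 0`, then `L(s, χ) ≠ 0` for `Re s > σ₀`. The analytic
continuation `s ∫₁^∞ ψ(x, χ) x^{-s-1} dx` of `−L'/L` to `Re s > σ₀` and the entire function
`L(s, χ)` feed the tree's abstract Landau step `LaplaceProgressions.coeff_eq_zero_of_sum_logDeriv`.
[cite: MontgomeryVaughan2007, §15.1 (with Thm. 1.3)] -/
theorem LFunction_ne_zero_of_isBigO [NeZero q] (hχ : χ ≠ 1) {σ₀ : ℝ} (hσ₀ : 0 < σ₀)
    (hψ : chebyshevPsiChar χ =O[atTop] fun x : ℝ ↦ x ^ σ₀) {s : ℂ} (hs : σ₀ < s.re) :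
    χ.LFunction s ≠ 0 := by
  rcases le_or_gt 1 s.re with h1 | h1
  · exact DirichletCharacter.LFunction_ne_zero_of_one_le_re χ (.inl hχ) h1
  intro h0
  have hσ1 : σ₀ < 1 := hs.trans h1
  have h2U : (2 : ℂ) ∈ {w : ℂ | σ₀ < w.re} := by
    simp only [mem_setOf_eq]; norm_num; linarith
  have h2V : (2 : ℂ) ∈ {w : ℂ | 1 < w.re} := by simp only [mem_setOf_eq]; norm_num
  have hL2 : χ.LFunction 2 ≠ 0 :=
    DirichletCharacter.LFunction_ne_zero_of_one_le_re χ (.inl hχ) (by norm_num)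
  have key := LaplaceProgressions.coeff_eq_zero_of_sum_logDeriv (ι := Unit)
    (U := {w : ℂ | σ₀ < w.re}) (V := {w : ℂ | 1 < w.re})
    (isOpen_lt continuous_const continuous_re) (convex_halfSpace_re_gt σ₀).isPreconnected
    (isOpen_lt continuous_const continuous_re) (fun w (hw : 1 < w.re) ↦ hσ1.trans hw)
    (f := fun _ ↦ χ.LFunction) (fun _ ↦ (differentiable_LFunction hχ).differentiableOn)
    (g := fun w ↦ w * mellin (chebyshevPsiChar χ) (-w))
    (fun w hw ↦ ((differentiableAt_id.mul (differentiableAt_mellin χ hψ hw))).differentiableWithinAt)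
    (fun _ ↦ (1 : ℂ)) (fun _ w hw ↦ DirichletCharacter.LFunction_ne_zero_of_one_le_re χ (.inl hχ) (le_of_lt hw))
    (fun w hw ↦ by
      have hw : 1 < w.re := hw
      simp only [Finset.univ_unique, Finset.sum_singleton, one_mul]
      exact (neg_logDeriv_eq χ hσ₀.le hψ hw (hσ1.trans hw)).symm)
    h2V (i₀ := ()) (w₀ := s) hs h0 (fun i hi ↦ absurd (Subsingleton.elim i ()) hi) h2U hL2
  exact one_ne_zero key

/-- `C x^{1/2} log² x = O(x^{σ₀})` for every `σ₀ > 1/2`: an explicit Titchmarsh-type bound on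
`ψ(x, χ)` from some point on makes `ψ(x, χ) = O(x^{σ₀})`. [folklore] -/
private theorem isBigO_rpow_of_bound {C x₀ : ℝ}
    (h : ∀ x : ℝ, x₀ ≤ x → ‖chebyshevPsiChar χ x‖ ≤ C * x ^ (1 / 2 : ℝ) * Real.log x ^ 2)
    {σ₀ : ℝ} (hσ₀ : 1 / 2 < σ₀) :
    chebyshevPsiChar χ =O[atTop] fun x : ℝ ↦ x ^ σ₀ := by
  have h1 : chebyshevPsiChar χ =O[atTop] fun x : ℝ ↦ x ^ (1 / 2 : ℝ) * Real.log x ^ 2 := by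
    refine IsBigO.of_bound C ?_
    filter_upwards [eventually_ge_atTop x₀, eventually_ge_atTop (1 : ℝ)] with x hx hx1
    rw [Real.norm_of_nonneg (by positivity), ← mul_assoc]
    exact h x hx
  refine h1.trans ?_
  have h2 : (fun x : ℝ ↦ Real.log x ^ 2) =o[atTop] fun x : ℝ ↦ x ^ (σ₀ - 1 / 2) := by
    refine (isLittleO_log_rpow_rpow_atTop (2 : ℝ) (by linarith : 0 < σ₀ - 1 / 2)).congr' ?_
      EventuallyEq.rfl
    filter_upwards with x
    exact Real.rpow_two (Real.log x)
  refine ((isBigO_refl (fun x : ℝ ↦ x ^ (1 / 2 : ℝ)) atTop).mul h2.isBigO).trans_eventuallyEq ?_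
  filter_upwards [eventually_gt_atTop (0 : ℝ)] with x hx
  rw [← Real.rpow_add hx]
  norm_num

end Converse

/-! ### The easy half: the uniform bound implies GRH -/

/-- **The uniform bound forces the Riemann hypothesis for every primitive `L(s, χ)`.** For the
character mod `1` this is von Koch's converse for `ζ`; for a primitive `χ` mod `d > 1`,
`|ψ(x, χ)| ≤ ∑_{a ∈ (ℤ/d)ˣ} |ψ(x; d, a) − x/φ(d)| ≤ φ(d) C x^{1/2} log² x` for `x ≥ max(2, d)`
gives `L(s, χ) ≠ 0` on `Re s > 1/2` (`LFunction_ne_zero_of_isBigO`), and the reflection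
`ρ ↦ 1 − ρ̄` of the zeros of a primitive `L`-function excludes `Re ρ < 1/2`.
[cite: Bordelles2020ArithmeticTales, Thm 3.42; MontgomeryVaughan2007, §15.1 and §10.1] -/
theorem riemannHypothesis_of_bound {C : ℝ}
    (hB : ∀ x : ℝ, 2 ≤ x → ∀ q : ℕ, 1 ≤ q → (q : ℝ) ≤ x → ∀ a : ZMod q, IsUnit a →
      |LevelOfDistribution.chebyshevPsiMod q a x - x / (Nat.totient q : ℝ)| ≤
        C * x ^ (1 / 2 : ℝ) * Real.log x ^ 2)
    {d : ℕ} [NeZero d] (ψχ : DirichletCharacter ℂ d) (hprim : ψχ.IsPrimitive) :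
    ψχ.RiemannHypothesis := by
  rcases eq_or_ne d 1 with rfl | hd
  · -- the character mod `1`: `L(s, χ) = ζ(s)` and `ψ(x; 1, ·) = ψ(x)`
    have hRH : RiemannHypothesis := by
      refine riemannHypothesis_of_chebyshevPsi_isBigO' (IsBigO.of_bound C ?_)
      filter_upwards [eventually_ge_atTop (2 : ℝ)] with x hx
      have h := hB x hx 1 le_rfl (by exact_mod_cast (by linarith : (1 : ℝ) ≤ x)) (1 : ZMod 1)
        isUnit_one
      rw [show LevelOfDistribution.chebyshevPsiMod 1 1 x = ψ x from
        ParityWave0.chebyshevPsiMod_one 1 x, Nat.totient_one, Nat.cast_one, div_one] at h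
      rwa [Real.norm_eq_abs, Real.norm_of_nonneg (by positivity), ← mul_assoc]
    exact (riemannHypothesisStrip_iff_forall_dirichletCharacter_one.mp
      (riemannHypothesis_iff_strip_holds.mp hRH)) ψχ
  · have hψ1 : ψχ ≠ 1 := by
      intro h
      rw [h, isPrimitive_def, conductor_one] at hprim
      exact hd hprim.symm
    -- `|ψ(x, χ)| ≤ φ(d) C x^{1/2} log² x` for `x ≥ max(2, d)`
    have hbd : ∀ x : ℝ, max 2 (d : ℝ) ≤ x →
        ‖chebyshevPsiChar ψχ x‖ ≤ (d.totient * C) * x ^ (1 / 2 : ℝ) * Real.log x ^ 2 := by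
      intro x hx
      have hx2 : 2 ≤ x := (le_max_left _ _).trans hx
      have hxd : (d : ℝ) ≤ x := (le_max_right _ _).trans hx
      calc ‖chebyshevPsiChar ψχ x‖
          ≤ ∑ a : (ZMod d)ˣ, |ParityWave0.chebyshevPsiMod d a x - x / Nat.totient d| :=
            norm_chebyshevPsiChar_le_sum_units hψ1 x
        _ ≤ ∑ _a : (ZMod d)ˣ, C * x ^ (1 / 2 : ℝ) * Real.log x ^ 2 :=
            Finset.sum_le_sum fun a _ ↦ hB x hx2 d NeZero.one_le hxd (a : ZMod d) a.isUnit
        _ = (d.totient * C) * x ^ (1 / 2 : ℝ) * Real.log x ^ 2 := by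
            rw [Finset.sum_const, Finset.card_univ, ZMod.card_units_eq_totient, nsmul_eq_mul]
            ring
    intro s hs0 h0 h1
    rcases lt_trichotomy s.re (1 / 2) with hlt | heq | hgt
    · -- a zero to the left of the line reflects to one on the right
      have h' := LFunction_one_sub_conj_eq_zero hprim hd hs0 h0
      have hre : (1 - (starRingEnd ℂ) s).re = 1 - s.re := by simp
      exact absurd h' (LFunction_ne_zero_of_isBigO ψχ hψ1 (σ₀ := (1 - s.re + 1 / 2) / 2)
        (by linarith) (isBigO_rpow_of_bound ψχ hbd (by linarith)) (by rw [hre]; linarith))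
    · exact heq
    · exact absurd hs0 (LFunction_ne_zero_of_isBigO ψχ hψ1 (σ₀ := (s.re + 1 / 2) / 2)
        (by linarith) (isBigO_rpow_of_bound ψχ hbd (by linarith)) (by linarith))

/-- **⟸ of Titchmarsh's criterion**: the uniform bound implies GRH (every character reduces to
the primitive character inducing it, `DirichletCharacter.riemannHypothesis_iff_primitiveCharacter_holds`).
[cite: Bordelles2020ArithmeticTales, Thm 3.42] -/
theorem generalizedRiemannHypothesis_of_bound {C : ℝ}
    (hB : ∀ x : ℝ, 2 ≤ x → ∀ q : ℕ, 1 ≤ q → (q : ℝ) ≤ x → ∀ a : ZMod q, IsUnit a →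
      |LevelOfDistribution.chebyshevPsiMod q a x - x / (Nat.totient q : ℝ)| ≤
        C * x ^ (1 / 2 : ℝ) * Real.log x ^ 2) :
    GeneralizedRiemannHypothesis := by
  intro N _ χ
  haveI : NeZero χ.conductor := ⟨χ.conductor_ne_zero⟩
  exact (DirichletCharacter.riemannHypothesis_iff_primitiveCharacter_holds χ).2
    (riemannHypothesis_of_bound hB χ.primitiveCharacter (primitiveCharacter_isPrimitive χ))

/-! ### Titchmarsh's theorem: GRH implies the uniform bound -/

/-- **Von Koch's theorem with an explicit constant on `[2, ∞)`**: under RH there is `C ≥ 0` with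
`|ψ(x) − x| ≤ C x^{1/2} log² x` for all `x ≥ 2` (the tree's `IsBigO` form
`vonKoch_chebyshevPsi_of_riemannHypothesis_holds` on `[X, ∞)`, and `|ψ(x) − x| ≤ ψ(X) + X`,
`x^{1/2} log² x ≥ 1/4` on `[2, X]`). [cite: MontgomeryVaughan2007, Thm. 13.1] -/
theorem exists_abs_psi_sub_le_of_RH (hRH : RiemannHypothesis) :
    ∃ C : ℝ, 0 ≤ C ∧ ∀ x : ℝ, 2 ≤ x → |ψ x - x| ≤ C * x ^ (1 / 2 : ℝ) * Real.log x ^ 2 := by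
  have hO := vonKoch_chebyshevPsi_of_riemannHypothesis_holds hRH
  obtain ⟨c, hc0, hc⟩ := hO.exists_pos
  rw [Asymptotics.isBigOWith_iff, eventually_atTop] at hc
  obtain ⟨X₀, hX₀⟩ := hc
  set X : ℝ := max X₀ 2 with hXdef
  have hX2 : 2 ≤ X := le_max_right _ _
  have hM0 : 0 ≤ ψ X + X := add_nonneg (Chebyshev.psi_nonneg X) (by linarith)
  refine ⟨c + 4 * (ψ X + X), by positivity, fun x hx ↦ ?_⟩
  have hx0 : 0 < x := by linarith
  have hB0 : 0 ≤ x ^ (1 / 2 : ℝ) * Real.log x ^ 2 := by positivity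
  rcases le_or_gt X x with hXx | hxX
  · have h := hX₀ x ((le_max_left _ _).trans hXx)
    rw [Real.norm_eq_abs, Real.norm_of_nonneg hB0] at h
    calc |ψ x - x| ≤ c * (x ^ (1 / 2 : ℝ) * Real.log x ^ 2) := h
      _ ≤ (c + 4 * (ψ X + X)) * (x ^ (1 / 2 : ℝ) * Real.log x ^ 2) := by gcongr; linarith
      _ = (c + 4 * (ψ X + X)) * x ^ (1 / 2 : ℝ) * Real.log x ^ 2 := by ring
  · have hM : |ψ x - x| ≤ ψ X + X := by
      rw [abs_le]
      constructor
      · linarith [Chebyshev.psi_nonneg x, Chebyshev.psi_nonneg X, hxX.le]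
      · linarith [Chebyshev.psi_mono hxX.le]
    have hlow : 1 / 4 ≤ x ^ (1 / 2 : ℝ) * Real.log x ^ 2 := by
      have h1 : 1 ≤ x ^ (1 / 2 : ℝ) := Real.one_le_rpow (by linarith) (by norm_num)
      have h2 : 1 / 2 ≤ Real.log x :=
        le_trans (by linarith [Real.log_two_gt_d9]) (Real.log_le_log two_pos hx)
      nlinarith
    calc |ψ x - x| ≤ ψ X + X := hM
      _ ≤ 4 * (ψ X + X) * (x ^ (1 / 2 : ℝ) * Real.log x ^ 2) := by nlinarith
      _ ≤ (c + 4 * (ψ X + X)) * (x ^ (1 / 2 : ℝ) * Real.log x ^ 2) := by gcongr; linarith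
      _ = (c + 4 * (ψ X + X)) * x ^ (1 / 2 : ℝ) * Real.log x ^ 2 := by ring

/-- **⟹ of Titchmarsh's criterion = Titchmarsh's theorem (MV Cor. 13.8)**: under GRH there is an
absolute `C` with `|ψ(x; q, a) − x/φ(q)| ≤ C x^{1/2} log² x` for all `x ≥ 2`, `1 ≤ q ≤ x`,
`(a, q) = 1`. Printed road: orthogonality `|ψ(x; q, a) − x/φ(q)| ≤ φ(q)⁻¹ ∑_χ |ψ'(x, χ)|`; the
principal character contributes `|ψ(x) − x| + R(q, x)`, a non-principal `χ` induced by the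
primitive `χ⋆` mod `d`, `1 < d ≤ q ≤ x`, contributes `|ψ(x, χ⋆)| + R(q, x)` with
`|ψ(x, χ⋆)| ≤ A x^{1/2}(log x) log(dx) ≤ 2A x^{1/2} log² x` (MV (13.19)) and
`R(q, x) = ∑_{n ≤ x, (n,q)>1} Λ(n) ≤ (log x/log 2) log q ≤ 2 x^{1/2} log² x` (MV (12.13)); there
are `φ(q)` characters. [cite: MontgomeryVaughan2007, §13.1 Thm. 13.7–Cor. 13.8; Titchmarsh1930Divisor, main theorem] -/
theorem bound_of_generalizedRiemannHypothesis (hGRH : GeneralizedRiemannHypothesis) :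
    ∃ C : ℝ, ∀ x : ℝ, 2 ≤ x → ∀ q : ℕ, 1 ≤ q → (q : ℝ) ≤ x → ∀ a : ZMod q, IsUnit a →
      |LevelOfDistribution.chebyshevPsiMod q a x - x / (Nat.totient q : ℝ)| ≤
        C * x ^ (1 / 2 : ℝ) * Real.log x ^ 2 := by
  have hRH : RiemannHypothesis :=
    riemannHypothesis_iff_strip_holds.mpr
      (riemannHypothesisStrip_iff_forall_dirichletCharacter_one.mpr fun χ ↦ hGRH 1 χ)
  obtain ⟨C₁, hC₁0, hC₁⟩ := exists_abs_psi_sub_le_of_RH hRH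
  obtain ⟨A, hA0, hA⟩ := GRHPrimeCharSum.exists_norm_chebyshevPsiChar_le
  refine ⟨C₁ + 2 * A + 2, fun x hx q hq hqx a ha ↦ ?_⟩
  haveI : NeZero q := ⟨by omega⟩
  classical
  set B : ℝ := x ^ (1 / 2 : ℝ) * Real.log x ^ 2 with hB
  have hx0 : 0 < x := by linarith
  have hs1 : 1 ≤ x ^ (1 / 2 : ℝ) := Real.one_le_rpow (by linarith) (by norm_num)
  have hlog2 : 1 / 2 < Real.log 2 := by linarith [Real.log_two_gt_d9]
  have hlogx : 1 / 2 ≤ Real.log x := le_trans hlog2.le (Real.log_le_log two_pos hx)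
  have hlog0 : 0 ≤ Real.log x := by linarith
  have hB0 : 0 ≤ B := by positivity
  have hq0 : (0 : ℝ) < q := by exact_mod_cast hq
  -- `R(q, x) ≤ 2B` (MV (12.13))
  have hR : nonCoprimePart q x ≤ 2 * B := by
    have h := nonCoprimePart_le (NeZero.ne q) hx0.le
    have hfl : (⌊Real.log x / Real.log 2⌋₊ : ℝ) ≤ Real.log x / Real.log 2 :=
      Nat.floor_le (div_nonneg hlog0 (by linarith))
    have hlogq : Real.log q ≤ Real.log x := Real.log_le_log hq0 hqx
    have hlogq0 : 0 ≤ Real.log q := Real.log_natCast_nonneg q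
    have hinv : 1 / Real.log 2 ≤ 2 * x ^ (1 / 2 : ℝ) := by
      rw [div_le_iff₀ (by linarith)]
      nlinarith
    calc nonCoprimePart q x ≤ ⌊Real.log x / Real.log 2⌋₊ * Real.log q := h
      _ ≤ (Real.log x / Real.log 2) * Real.log x := mul_le_mul hfl hlogq hlogq0 (by positivity)
      _ = (1 / Real.log 2) * Real.log x ^ 2 := by ring
      _ ≤ (2 * x ^ (1 / 2 : ℝ)) * Real.log x ^ 2 := by gcongr
      _ = 2 * B := by rw [hB]; ring
  -- per-character bound `|ψ'(x, χ)| ≤ (C₁ + 2A + 2) B`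
  have hχ : ∀ χ : DirichletCharacter ℂ q, ‖psiPrime χ x‖ ≤ (C₁ + 2 * A + 2) * B := by
    intro χ
    by_cases h1 : χ = 1
    · subst h1
      have h := norm_psiPrime_changeLevel_le (one_dvd q) (1 : DirichletCharacter ℂ 1) x
      rw [map_one] at h
      have h0 : ‖psiPrime (1 : DirichletCharacter ℂ 1) x‖ = |ψ x - x| := by
        rw [psiPrime_one, chebyshevPsiChar_level_one, ← Complex.ofReal_sub, Complex.norm_real,
          Real.norm_eq_abs]
      have hvk := hC₁ x hx
      calc ‖psiPrime (1 : DirichletCharacter ℂ q) x‖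
          ≤ ‖psiPrime (1 : DirichletCharacter ℂ 1) x‖ + nonCoprimePart q x := h
        _ ≤ C₁ * B + 2 * B := by
            rw [h0]
            exact add_le_add (by rw [hB, ← mul_assoc]; exact hvk) hR
        _ ≤ (C₁ + 2 * A + 2) * B := by nlinarith
    · set d := χ.conductor with hd
      haveI : NeZero d := ⟨χ.conductor_ne_zero⟩
      have hd1 : d ≠ 1 := fun h ↦ h1 ((DirichletCharacter.eq_one_iff_conductor_eq_one (χ := χ)).2 h)
      have hdgt : 1 < d := by have := NeZero.ne d; omega
      have hdq : d ≤ q := Nat.le_of_dvd (by omega) χ.conductor_dvd_level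
      have hprim : χ.primitiveCharacter.IsPrimitive := primitiveCharacter_isPrimitive χ
      have hne1 : χ.primitiveCharacter ≠ 1 := by
        intro h
        have := (isPrimitive_def _).1 hprim
        rw [h, conductor_one] at this
        exact hd1 this.symm
      have hRHd : χ.primitiveCharacter.RiemannHypothesis := hGRH d χ.primitiveCharacter
      have h := norm_psiPrime_changeLevel_le χ.conductor_dvd_level χ.primitiveCharacter x
      rw [changeLevel_primitiveCharacter, psiPrime_of_ne_one hne1] at h
      have hAx := hA d χ.primitiveCharacter hprim hdgt hRHd x hx
      have hdx : (d : ℝ) * x ≤ x * x :=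
        mul_le_mul_of_nonneg_right ((by exact_mod_cast hdq : (d : ℝ) ≤ q).trans hqx) hx0.le
      have hlogdx : Real.log (d * x) ≤ 2 * Real.log x := by
        rw [two_mul, ← Real.log_mul hx0.ne' hx0.ne']
        exact Real.log_le_log (by positivity) hdx
      have hAx' : ‖chebyshevPsiChar χ.primitiveCharacter x‖ ≤ 2 * A * B := by
        calc ‖chebyshevPsiChar χ.primitiveCharacter x‖
            ≤ A * x ^ (1 / 2 : ℝ) * Real.log x * Real.log (d * x) := hAx
          _ ≤ A * x ^ (1 / 2 : ℝ) * Real.log x * (2 * Real.log x) := by gcongr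
          _ = 2 * A * B := by rw [hB]; ring
      calc ‖psiPrime χ x‖ ≤ ‖chebyshevPsiChar χ.primitiveCharacter x‖ + nonCoprimePart q x := h
        _ ≤ 2 * A * B + 2 * B := add_le_add hAx' hR
        _ ≤ (C₁ + 2 * A + 2) * B := by nlinarith
  -- orthogonality and the count of characters
  have hsum := abs_chebyshevPsiMod_sub_le q ha.unit x
  rw [IsUnit.unit_spec] at hsum
  have hcard : (Finset.univ : Finset (DirichletCharacter ℂ q)).card = q.totient := by
    rw [Finset.card_univ, ← Nat.card_eq_fintype_card,
      DirichletCharacter.card_eq_totient_of_hasEnoughRootsOfUnity ℂ q]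
  have hφ : 0 < (q.totient : ℝ) := by exact_mod_cast Nat.totient_pos.2 (by omega)
  calc |LevelOfDistribution.chebyshevPsiMod q a x - x / (q.totient : ℝ)|
      = |ParityWave0.chebyshevPsiMod q a x - x / (q.totient : ℝ)| := rfl
    _ ≤ (q.totient : ℝ)⁻¹ * ∑ χ : DirichletCharacter ℂ q, ‖psiPrime χ x‖ := hsum
    _ ≤ (q.totient : ℝ)⁻¹ * ∑ _χ : DirichletCharacter ℂ q, (C₁ + 2 * A + 2) * B := by
        gcongr with χ
        exact hχ χ
    _ = (C₁ + 2 * A + 2) * B := by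
        rw [Finset.sum_const, hcard, nsmul_eq_mul]
        field_simp
    _ = (C₁ + 2 * A + 2) * x ^ (1 / 2 : ℝ) * Real.log x ^ 2 := by rw [hB]; ring

/-! ### The discharge -/

end TitchmarshGRH

/-- **Titchmarsh's GRH criterion, PROVED as an equivalence** — discharge of the named fact
`Titchmarsh1930_GRH_criterion` (Broughan Vol. 2 Ch. 12 §§12.6–12.7; Bordellès, *Arithmetic
Tales* (2020) Thm 3.42; Titchmarsh 1930): the generalized Riemann hypothesis (every Dirichlet
`L(s, χ)` zero-free off `Re s = 1/2` in the open strip) holds iff there is an absolute `C` with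
`|ψ(x; q, a) − x/φ(q)| ≤ C x^{1/2} (log x)²` for all `x ≥ 2`, `1 ≤ q ≤ x`, `(a, q) = 1`.
[cite: Titchmarsh1930Divisor, main theorem (as printed in Bordelles2020ArithmeticTales Thm 3.42); MontgomeryVaughan2007, §13.1 Cor. 13.8 and §15.1] -/
theorem Titchmarsh1930_GRH_criterion_holds : Titchmarsh1930_GRH_criterion :=
  ⟨TitchmarshGRH.bound_of_generalizedRiemannHypothesis,
    fun ⟨_, hC⟩ ↦ TitchmarshGRH.generalizedRiemannHypothesis_of_bound hC⟩

end Literature.NumberTheory.LFunctions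

end
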